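import Mathlib
import Summits.Ventures.PercRepro.TriangleCapBandNoGap
import Summits.Ventures.PercRepro.TriangleCapSpectrumExact
import Summits.Ventures.PercRepro.TriangleCapBandDistinct

/-!
# PercRepro — THE TOP `T` LAYERS OF THE PAIR-COUNT SPECTRUM ON EXACTLY `n` VERTICES, EXACTLY (p3, gen 53; part 277)

`bandCond ℓ t j` is the parameter-free description of part 276: the three extremal bounds of part 247 with `ℓ`
non-neighbours and no gap between consecutive sub-bands.  **THEOREM** (`pair_count_spectrum_vertices`; `4 T + 3 ≤ s`,
`2 s ≥ 4 T + 6 + T (T + 1)`, `s + 3 ≤ n`): (i) every triangle-free graph on `n` vertices with `s` edges whose pair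
count lies above the level-`T` tail (`Σ d² + 2 (T + 1)(s − T − 2) > s (s + 1)`) sits in a band `t ≤ T` at a value
`j` with `bandCond (n − 1 − (s − t)) t j`; (ii) every such pair `(t, j)` lies above the tail and is attained on
exactly `n` vertices.  With the distinctness of the band values (part 248) the top `T` layers of the spectrum on `n`
vertices are EXACTLY the values `s (s + 1) − 2 t (s − t − 1) − 2 j` with `t ≤ T` and `bandCond (n − 1 − (s − t)) t j`
(`pair_count_spectrum_vertices_iff`).  The star layer `t = 0` is the star `K_{1,s}` on `n ≥ s + 1` vertices
(`star_attained_vertices`, part 238's construction on `n` vertices).  Part 276's one-statement description is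
restated here under primed names (`band_iff_all'`, `pair_count_vertices_iff'`: the module imports part 275 directly,
the olean of part 276 not being built at filing time).  Axioms: standard.
-/

namespace PercRepro

namespace TriangleCap

namespace C047

open Finset

/-- No gap above an overlapping sub-band (parity; part 276 restated). -/
theorem no_gap_of_overlap' (ℓ t u j : ℕ)
    (hov : 2 * ((u + 1) * (t - u - 2)) ≤ 2 * (u * (t - u - 1)) + twoW ℓ u + 2) :
    ¬ (2 * (u * (t - u - 1)) + twoW ℓ u < 2 * j ∧ j < (u + 1) * (t - u - 2)) := by
  rintro ⟨h1, h2⟩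
  obtain ⟨x, hx⟩ := twoW_even ℓ u
  omega

/-- **THE BAND ON `n` VERTICES, EVERY `ℓ`, IN ONE STATEMENT** (part 276 restated): for `2 ≤ ℓ`, `1 ≤ t`, `2 t ≤ s`, the
band value `2 j` is attained on `ℓ + 1 + (s − t)` vertices IFF `j` satisfies the three extremal bounds of part 247 and,
for no `u`, `2 u (t − u − 1) + twoW ℓ u < 2 j` and `j < (u + 1)(t − u − 2)`. -/
theorem band_iff_all' (ℓ s t j : ℕ) (hℓ : 2 ≤ ℓ) (ht : 1 ≤ t) (hs : 2 * t ≤ s) :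
    (∃ (H : SimpleGraph (Fin (ℓ + 1 + (s - t)))) (_ : DecidableRel H.Adj), H.CliqueFree 3 ∧
      H.edgeFinset.card = s ∧ (∃ w, deg H w + t = s) ∧
      ∑ v, deg H v * deg H v + 2 * (t * (s - t - 1)) + 2 * j = s * (s + 1)) ↔
    ((2 * j ≤ t * (t + 1) ∧ (t ≤ ℓ → 2 * j + 2 * t ≤ t * (t - 1) + 2 * ℓ) ∧
        (ℓ ≤ t → 2 * j + 2 * (t / ℓ) * t ≤ t * (t - 1) + ℓ * ((t / ℓ) * (t / ℓ + 1)))) ∧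
      ∀ u, ¬ (2 * (u * (t - u - 1)) + twoW ℓ u < 2 * j ∧ j < (u + 1) * (t - u - 2))) := by
  rcases Nat.lt_or_ge (ℓ + 2) t with h3 | h2
  · rw [band_iff_no_gap ℓ s t j hℓ (by omega) hs]
    have hq1 : 1 ≤ t / ℓ := Nat.div_pos (by omega) (by omega)
    have hqt : ℓ * (t / ℓ) ≤ t := Nat.mul_div_le t ℓ
    constructor
    · rintro ⟨hb, hng⟩
      refine ⟨⟨?_, fun h => by omega, fun _ => hb⟩, hng⟩
      have h1 : ℓ * ((t / ℓ) * (t / ℓ + 1)) ≤ 2 * (t / ℓ) * t := by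
        have : ℓ * ((t / ℓ) * (t / ℓ + 1)) = (t / ℓ) * (ℓ * (t / ℓ)) + ℓ * (t / ℓ) := by ring
        rw [this]
        have h2 : (t / ℓ) * (ℓ * (t / ℓ)) ≤ (t / ℓ) * t := Nat.mul_le_mul_left _ hqt
        nlinarith
      have h3 : t * (t - 1) ≤ t * (t + 1) := Nat.mul_le_mul_left _ (by omega)
      omega
    · rintro ⟨⟨-, -, hb⟩, hng⟩
      exact ⟨hb (by omega), hng⟩
  · constructor
    · rintro ⟨H, _, hfree, hs', ⟨w, hw⟩, hj'⟩
      refine ⟨(vertex_band_extremal ℓ s t (by omega) ht hs).1 H hfree hs' w hw j hj', fun u => ?_⟩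
      have hov0 : 2 * ((0 + 1) * (t - 0 - 2)) ≤ 2 * (0 * (t - 0 - 1)) + twoW ℓ 0 + 2 := by
        rw [twoW_zero]
        omega
      exact no_gap_of_overlap' ℓ t u j (overlap_of_le ℓ t 0 hov0 u (Nat.zero_le u))
    · rintro ⟨⟨hb1, hb2, hb3⟩, -⟩
      exact (band_interval_iff_all ℓ s t hℓ ht hs).mpr h2 j hb1 hb2 hb3

/-- **THE PAIR-COUNT SPECTRUM OF THE LAYER `t` ON EXACTLY `n` VERTICES** (part 276 restated): for `1 ≤ t`, `2 t ≤ s`,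
`s − t + 3 ≤ n` and `ℓ = n − 1 − (s − t)`, a triangle-free graph on `n` vertices with `s` edges, a vertex of degree
`s − t` and `Σ d² + 2 t (s − t − 1) + 2 j = s (s + 1)` exists IFF `j` satisfies the three extremal bounds with `ℓ`
non-neighbours and is never strictly between the top of a sub-band and the bottom of the next. -/
theorem pair_count_vertices_iff' (n s t j : ℕ) (ht : 1 ≤ t) (hs : 2 * t ≤ s) (hn : s - t + 3 ≤ n) :
    (∃ (H : SimpleGraph (Fin n)) (_ : DecidableRel H.Adj), H.CliqueFree 3 ∧
      H.edgeFinset.card = s ∧ (∃ w, deg H w + t = s) ∧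
      ∑ v, deg H v * deg H v + 2 * (t * (s - t - 1)) + 2 * j = s * (s + 1)) ↔
    ((2 * j ≤ t * (t + 1) ∧ (t ≤ n - 1 - (s - t) → 2 * j + 2 * t ≤ t * (t - 1) + 2 * (n - 1 - (s - t))) ∧
        (n - 1 - (s - t) ≤ t → 2 * j + 2 * (t / (n - 1 - (s - t))) * t ≤
          t * (t - 1) + (n - 1 - (s - t)) * ((t / (n - 1 - (s - t))) * (t / (n - 1 - (s - t)) + 1)))) ∧
      ∀ u, ¬ (2 * (u * (t - u - 1)) + twoW (n - 1 - (s - t)) u < 2 * j ∧ j < (u + 1) * (t - u - 2))) := by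
  obtain ⟨ℓ, hℓ⟩ : ∃ ℓ, n - 1 - (s - t) = ℓ := ⟨_, rfl⟩
  have hn' : n = ℓ + 1 + (s - t) := by omega
  subst hn'
  rw [hℓ]
  exact band_iff_all' ℓ s t j (by omega) ht hs

/-- The band condition on `ℓ + 1 + (s − t)` vertices (part 276): the three extremal bounds and no gap between
consecutive sub-bands. -/
def bandCond (ℓ t j : ℕ) : Prop :=
  (2 * j ≤ t * (t + 1) ∧ (t ≤ ℓ → 2 * j + 2 * t ≤ t * (t - 1) + 2 * ℓ) ∧
    (ℓ ≤ t → 2 * j + 2 * (t / ℓ) * t ≤ t * (t - 1) + ℓ * ((t / ℓ) * (t / ℓ + 1)))) ∧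
  ∀ u, ¬ (2 * (u * (t - u - 1)) + twoW ℓ u < 2 * j ∧ j < (u + 1) * (t - u - 2))

/-- The star layer: `bandCond ℓ 0 j ↔ j = 0`. -/
theorem bandCond_zero (ℓ j : ℕ) : bandCond ℓ 0 j ↔ j = 0 := by
  unfold bandCond
  constructor
  · rintro ⟨⟨h, -, -⟩, -⟩
    omega
  · rintro rfl
    refine ⟨⟨by omega, fun _ => by omega, fun _ => by simp⟩, fun u ⟨h, _⟩ => by omega⟩

/-- **THE STAR ON `n` VERTICES:** for `1 ≤ s`, `s + 1 ≤ n`, a triangle-free graph on `n` vertices with `s` edges and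
`Σ d² = s (s + 1)` (the missing graph of `bipMinusStar n 1 s`). -/
theorem star_attained_vertices (n s : ℕ) (hs : 1 ≤ s) (hn : s + 1 ≤ n) :
    ∃ (H : SimpleGraph (Fin n)) (_ : DecidableRel H.Adj), H.CliqueFree 3 ∧ H.edgeFinset.card = s ∧
      ∑ v, deg H v * deg H v = s * (s + 1) := by
  have hB : BipSub (bipMinusStar n 1 s) (leftPart n 1) := fun x y h => bipMinusStar_bipartite n 1 s x y h
  have hE := card_edges_bipMinusStar n 1 s le_rfl (by omega)
  have hS := sum_deg_sq_bipMinusStar n 1 s le_rfl (by omega) (by omega)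
  rw [Fintype.card_fin] at hS
  have hbs := bipSub_sum_deg_sq_add_disjEdgePairs (bipMinusStar n 1 s) (leftPart n 1) hB 1 s
    (card_leftPart n 1 (by omega)) (by rw [Fintype.card_fin]; omega) (by rw [Fintype.card_fin]; omega)
  rw [Fintype.card_fin] at hbs
  have hr := card_edges_missingGraph (bipMinusStar n 1 s) (leftPart n 1) hB 1 s
    (card_leftPart n 1 (by omega)) (by rw [Fintype.card_fin]; omega)
  have hid := sum_deg_sq_add_disjEdgePairs (missingGraph (bipMinusStar n 1 s) (leftPart n 1))
  rw [hr] at hid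
  refine ⟨missingGraph (bipMinusStar n 1 s) (leftPart n 1), inferInstance,
    cliqueFree_of_bipSub _ _ (bipSub_missingGraph _ _), hr, ?_⟩
  omega

/-- **THE BAND CONDITION IS THE ATTAINMENT ON `n` VERTICES** (`1 ≤ t`, `2 t ≤ s`, `s − t + 3 ≤ n`). -/
theorem bandCond_iff (n s t j : ℕ) (ht : 1 ≤ t) (hs : 2 * t ≤ s) (hn : s - t + 3 ≤ n) :
    (∃ (H : SimpleGraph (Fin n)) (_ : DecidableRel H.Adj), H.CliqueFree 3 ∧
      H.edgeFinset.card = s ∧ (∃ w, deg H w + t = s) ∧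
      ∑ v, deg H v * deg H v + 2 * (t * (s - t - 1)) + 2 * j = s * (s + 1)) ↔
    bandCond (n - 1 - (s - t)) t j := by
  unfold bandCond
  exact pair_count_vertices_iff' n s t j ht hs hn

/-- **THE TOP `T` LAYERS OF THE PAIR-COUNT SPECTRUM ON EXACTLY `n` VERTICES** (`4 T + 3 ≤ s`,
`2 s ≥ 4 T + 6 + T (T + 1)`, `s + 3 ≤ n`): (i) every triangle-free graph on `n` vertices with `s` edges above the
level-`T` tail sits in a band `t ≤ T` at a value `j` with `bandCond (n − 1 − (s − t)) t j`; (ii) every such `(t, j)`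
lies above the tail and is attained on exactly `n` vertices. -/
theorem pair_count_spectrum_vertices (n T s : ℕ) (hs4 : 4 * T + 3 ≤ s) (hs : 4 * T + 6 + T * (T + 1) ≤ 2 * s)
    (hn : s + 3 ≤ n) :
    (∀ (H : SimpleGraph (Fin n)) [DecidableRel H.Adj], H.CliqueFree 3 → H.edgeFinset.card = s →
        s * (s + 1) < ∑ v, deg H v * deg H v + 2 * ((T + 1) * (s - T - 2)) →
        ∃ t, t ≤ T ∧ ∃ j, bandCond (n - 1 - (s - t)) t j ∧
          ∑ v, deg H v * deg H v + 2 * (t * (s - t - 1)) + 2 * j = s * (s + 1)) ∧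
      (∀ t, t ≤ T → ∀ j, bandCond (n - 1 - (s - t)) t j →
        2 * (t * (s - t - 1)) + 2 * j < 2 * ((T + 1) * (s - T - 2)) ∧
        ∃ (H : SimpleGraph (Fin n)) (_ : DecidableRel H.Adj), H.CliqueFree 3 ∧ H.edgeFinset.card = s ∧
          ∑ v, deg H v * deg H v + 2 * (t * (s - t - 1)) + 2 * j = s * (s + 1)) := by
  refine ⟨?_, ?_⟩
  · intro H _ hfree hm hlt
    obtain ⟨w, hwmax, hcard, j, hj, hlayer⟩ := pair_count_layer H hfree (by omega)
    rw [hm] at hcard hlayer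
    obtain ⟨t, ht⟩ : ∃ t, (offEdges H w).card = t := ⟨_, rfl⟩
    rw [ht] at hcard hj hlayer
    by_cases htT : t ≤ T
    · refine ⟨t, htT, j, ?_, ?_⟩
      · rcases Nat.eq_zero_or_pos t with rfl | hpos
        · rw [bandCond_zero]
          omega
        · have e : deg H w - 1 = s - t - 1 := by omega
          rw [e] at hlayer
          exact (bandCond_iff n s t j hpos (by omega) (by omega)).mp
            ⟨H, inferInstance, hfree, hm, ⟨w, by omega⟩, hlayer⟩
      · rcases Nat.eq_zero_or_pos t with rfl | hpos
        · simpa using hlayer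
        · have e : deg H w - 1 = s - t - 1 := by omega
          rw [e] at hlayer
          exact hlayer
    · exfalso
      have hΔ : ∀ v, deg H v + T + 1 ≤ H.edgeFinset.card := fun v => by
        have := hwmax v
        omega
      have := sum_deg_sq_le_of_maxdeg_level H hfree T (by omega) hΔ
      rw [hm] at this
      omega
  · intro t htT j hc
    have hj : 2 * j ≤ t * (t + 1) := hc.1.1
    refine ⟨band_lt_tail s T t j htT hs hj, ?_⟩
    rcases Nat.eq_zero_or_pos t with rfl | hpos
    · -- the star on `n ≥ s + 1` vertices
      rw [bandCond_zero] at hc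
      subst hc
      obtain ⟨H, _, hfree, hm, hsum⟩ := star_attained_vertices n s (by omega) (by omega)
      exact ⟨H, inferInstance, hfree, hm, by simpa using hsum⟩
    · obtain ⟨H, _, hfree, hm, -, hsum⟩ := (bandCond_iff n s t j hpos (by omega) (by omega)).mpr hc
      exact ⟨H, inferInstance, hfree, hm, hsum⟩

/-- **THE TOP `T` LAYERS OF THE SPECTRUM ON `n` VERTICES, EXACTLY:** a value `X` above the level-`T` tail is the pair
count of a triangle-free graph on `n` vertices with `s` edges IFF `X = s (s + 1) − 2 t (s − t − 1) − 2 j` for some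
`t ≤ T` and `j` with `bandCond (n − 1 − (s − t)) t j` (`4 T + 3 ≤ s`, `2 s ≥ 4 T + 6 + T (T + 1)`, `s + 3 ≤ n`). -/
theorem pair_count_spectrum_vertices_iff (n T s X : ℕ) (hs4 : 4 * T + 3 ≤ s) (hs : 4 * T + 6 + T * (T + 1) ≤ 2 * s)
    (hn : s + 3 ≤ n) (hX : s * (s + 1) < X + 2 * ((T + 1) * (s - T - 2))) :
    (∃ (H : SimpleGraph (Fin n)) (_ : DecidableRel H.Adj), H.CliqueFree 3 ∧ H.edgeFinset.card = s ∧
      ∑ v, deg H v * deg H v = X) ↔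
    ∃ t, t ≤ T ∧ ∃ j, bandCond (n - 1 - (s - t)) t j ∧ X + 2 * (t * (s - t - 1)) + 2 * j = s * (s + 1) := by
  obtain ⟨h1, h2⟩ := pair_count_spectrum_vertices n T s hs4 hs hn
  constructor
  · rintro ⟨H, _, hfree, hm, rfl⟩
    exact h1 H hfree hm hX
  · rintro ⟨t, htT, j, hc, hval⟩
    obtain ⟨-, H, _, hfree, hm, hsum⟩ := h2 t htT j hc
    exact ⟨H, inferInstance, hfree, hm, by omega⟩

end C047

end TriangleCap

end PercRepro
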